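import Summits.Ventures.LatticeQCDFlow.Scaling.GraphSchemeMixingCeiling
import Summits.Ventures.LatticeQCDFlow.Scaling.StarWilsonMode

/-!
HONEST FRAMING: exact (Metropolis-corrected) sampling algorithms for lattice gauge theory; figures
of merit are autocorrelation/cost numbers at stated couplings and volumes; no continuum-physics
claim.

# CompleteGraphWilsonMode — THE THIRD COMPUTED CASE: ON THE COMPLETE SWAP LIST (EVERY PAIR OF LEVELS LISTED `c` TIMES, `m = cK(K+1)/2`) THE TWO-VALUE VECTOR `(x, 1, …, 1)` WITH
# `(2t/(K+1))(1−x)(K+x) = hKx` IS THE GROUND STATE, `ρ = 2t(1−x)/(K(K+1)) = hx/(K+x)`, SO `max{K(K+1)/(2t), (K+1)/h} ≤ 1/ρ ≤ (K+1)²(h + 4t/(K+1))/(2ht)` — THE COMPLETE GRAPH IS THE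
# DILUTED STAR (`K²/t` FOR `K/t`), AND THE TWO-SIDED LAW OF FILE 7 HOLDS WITH THIS `ρ` (lean-2 GEN-47, ours)

Venture-side (OURS).  Cell `lqcd-flow` (pub-lqcd), unit `pub-lqcd-lean-2-g47`, 2026-08-31.  Chapter AH (the hub–ladder interpolation), file 10.  A COMPLETE LIST: every ordered-or-reversed pair
`{k, l}`, `k ≠ l`, occurs exactly `c ≥ 1` times among the entries (so `m = cK(K+1)/2`; chapter K's dilution).  By symmetry the vertex equations of file 1 reduce, for a vector with `c_0 = x`,
`c_{k+1} = 1`, to the leaf equation `(tc/m)(x − 1) = −ρ` and the hub equation `(tc/m)K(1−x) − hx = −ρx`; with `tc/m = 2t/(K(K+1))` these are the STAR's equations of file 3 at swap rate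
`2t/(K+1)`: `ρ = (2t/(K+1))(1−x)/K`, `(2t/(K+1))(1−x)(K+x) = hKx`.  File 3's root and bounds apply verbatim; file 7 gives the two-sided law.  NOT CLAIMED: sharpness of the floor's logarithm here — with `D² = (t+h)/ρ ≍ K²` and `Σc ≍ K` its argument
`(1−ν(u))(x+K)/(4√((t+h)/ρ))` is of order one, so the floor of this file records the unit `1/ρ` but not a `log K` (a finer increment bound — the hub entries move `Φ` by `x − 1`, of size
`≍ 1`, only when the hub is involved, probability `2/(K+1)` per swap — would restore it; left open).  No definitions.

* `complete_vertex_sum` (`Σ_r[…] = c·Σ_{l}(c_l − c_k)` on a complete list), **`complete_vertex_equations`**, **`completeGraph_rho_bounds`** (`0 < ρ`, `ρ ≤ 2t/(K(K+1))`, `ρ ≤ h/(K+1)`,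
  `1/ρ ≤ (K+1)²(h + 4t/(K+1))/(2ht)`), **`completeGraph_mixingTime_two_sided`** (file 7 with this `ρ`, `c_min = x`, `Σc = x + K`, `Δ = 1`).

Reading (no numerics implied): letting every pair of replicas swap (the complete graph) at total swap rate `t` relaxes the slow one-level mode at rate `≍ min{2t/K², h/K}` — each hub edge is
proposed with probability `2/(K(K+1))` instead of `1/K`: the star's `K/t` becomes `K²/(2t)`, the refresh budget `K/h` is unchanged; the path (`K³/t`) is slower still.  Literature grade (cell
rule): OWN; nothing cited; no new bib keys.
-/

noncomputable section

open Finset Function Real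
open Literature.Probability.MarkovChains

namespace Summit.Ventures.LatticeQCDFlow.Scaling

variable {S : Type*} [Fintype S] [DecidableEq S] {K m : ℕ} (e : Fin m → Fin (K + 1) × Fin (K + 1)) {ν : S → ℝ} {M : Fin (K + 1) → S → S → ℝ} {w : Fin (K + 1) → ℝ} {t : ℝ}
  {P : (Fin (K + 1) → S) → (Fin (K + 1) → S) → ℝ}

/-- **The vertex sum on a complete list:** if every pair `{k, l}` (`k ≠ l`) is listed exactly `cc` times (in either orientation) and endpoints are distinct, then
`Σ_r[1{k=i_r}(c_{l_r} − c_k) + 1{k=l_r}(c_{i_r} − c_k)] = cc·Σ_l(c_l − c_k)`. [ours] -/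
theorem complete_vertex_sum (he : ∀ r, (e r).1 ≠ (e r).2) {cc : ℕ}
    (hcomplete : ∀ k l : Fin (K + 1), k ≠ l → (univ.filter fun r : Fin m => ((e r).1 = k ∧ (e r).2 = l) ∨ ((e r).2 = k ∧ (e r).1 = l)).card = cc)
    (c : Fin (K + 1) → ℝ) (k : Fin (K + 1)) :
    ∑ r : Fin m, ((if k = (e r).1 then c (e r).2 - c (e r).1 else 0) + (if k = (e r).2 then c (e r).1 - c (e r).2 else 0))
      = cc * ∑ l : Fin (K + 1), (c l - c k) := by
  -- write each entry's contribution as a sum over the other endpoint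
  have hent : ∀ r : Fin m, ((if k = (e r).1 then c (e r).2 - c (e r).1 else 0) + (if k = (e r).2 then c (e r).1 - c (e r).2 else 0))
      = ∑ l : Fin (K + 1), (if ((e r).1 = k ∧ (e r).2 = l) ∨ ((e r).2 = k ∧ (e r).1 = l) then c l - c k else 0) := by
    intro r
    by_cases h1 : k = (e r).1
    · have h2 : k ≠ (e r).2 := fun h' => he r (h1.symm.trans h')
      rw [if_pos h1, if_neg h2, add_zero]
      rw [Finset.sum_eq_single (e r).2]
      · rw [if_pos (Or.inl ⟨h1.symm, rfl⟩), ← h1]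
      · intro l _ hl; rw [if_neg]; rintro (⟨_, h'⟩ | ⟨h', _⟩); exact hl h'.symm; exact h2 h'.symm
      · intro h'; exact absurd (mem_univ _) h'
    · by_cases h2 : k = (e r).2
      · rw [if_neg h1, if_pos h2, zero_add]
        rw [Finset.sum_eq_single (e r).1]
        · rw [if_pos (Or.inr ⟨h2.symm, rfl⟩), ← h2]
        · intro l _ hl; rw [if_neg]; rintro (⟨h', _⟩ | ⟨_, h'⟩); exact h1 h'.symm; exact hl h'.symm
        · intro h'; exact absurd (mem_univ _) h'
      · rw [if_neg h1, if_neg h2, add_zero]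
        refine (sum_eq_zero fun l _ => if_neg ?_).symm
        rintro (⟨h', _⟩ | ⟨h', _⟩); exact h1 h'.symm; exact h2 h'.symm
  simp_rw [hent]
  rw [sum_comm, mul_sum]
  refine sum_congr rfl fun l _ => ?_
  by_cases hkl : k = l
  · subst hkl; simp
  · rw [← Finset.sum_filter, sum_const, hcomplete k l hkl, nsmul_eq_mul]

/-- **A VECTOR WITH `c_0 = x`, `c_{k+1} = 1` SOLVES THE VERTEX EQUATIONS OF A COMPLETE LIST** (`m·2 = cc·K(K+1)`, `K ≥ 1`) with `ρ = (2t/(K+1))(1−x)/K` and hub weight `h`, given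
`(2t/(K+1))(1−x)(K+x) = hKx`. [ours] -/
theorem complete_vertex_equations (hK : 1 ≤ K) (he : ∀ r, (e r).1 ≠ (e r).2) {cc : ℕ} (hcc : 1 ≤ cc)
    (hcomplete : ∀ k l : Fin (K + 1), k ≠ l → (univ.filter fun r : Fin m => ((e r).1 = k ∧ (e r).2 = l) ∨ ((e r).2 = k ∧ (e r).1 = l)).card = cc)
    (hmc : (m : ℝ) * 2 = cc * K * ((K : ℝ) + 1)) {c : Fin (K + 1) → ℝ} {x hh ρ : ℝ} (hc0 : c 0 = x) (hck : ∀ i : Fin K, c i.succ = 1)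
    (hρ : ρ = 2 * t / ((K : ℝ) + 1) * (1 - x) / K) (hx : 2 * t / ((K : ℝ) + 1) * (1 - x) * (K + x) = hh * K * x) (k : Fin (K + 1)) :
    t / m * ∑ r : Fin m, ((if k = (e r).1 then c (e r).2 - c (e r).1 else 0) + (if k = (e r).2 then c (e r).1 - c (e r).2 else 0))
      - (if k = 0 then hh * c 0 else 0) = -ρ * c k := by
  have hKpos : (0 : ℝ) < K := Nat.cast_pos.mpr (by omega)
  have hccpos : (0 : ℝ) < cc := Nat.cast_pos.mpr (by omega)
  have hmpos : (0 : ℝ) < m := by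
    have : (0 : ℝ) < (m : ℝ) * 2 := by rw [hmc]; positivity
    linarith
  rw [complete_vertex_sum e he hcomplete c k]
  -- the symmetric sums
  have hsum : ∀ k : Fin (K + 1), ∑ l : Fin (K + 1), (c l - c k) = (x + K) - ((K : ℝ) + 1) * c k := by
    intro k
    rw [sum_sub_distrib, sum_const, card_univ, Fintype.card_fin, nsmul_eq_mul, Fin.sum_univ_succ, hc0]
    simp_rw [hck]
    simp
  rw [hsum]
  have hm' : t / m = 2 * t / (cc * K * ((K : ℝ) + 1)) := by
    rw [div_eq_div_iff hmpos.ne' (by positivity), ← hmc]; ring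
  have hx' : 2 * t * (1 - x) * (K + x) = hh * K * x * ((K : ℝ) + 1) := by
    have hK1 : ((K : ℝ) + 1) ≠ 0 := by positivity
    field_simp at hx
    linarith [hx]
  rw [hm']
  refine Fin.cases ?_ (fun i => ?_) k
  · rw [if_pos rfl, hc0, hρ]
    field_simp
    linear_combination hx'
  · rw [if_neg (Fin.succ_ne_zero i), hck i, hρ]
    field_simp
    ring

/-- **THE RATE ON THE COMPLETE LIST:** with `x ∈ (0,1)` solving `(2t/(K+1))(1−x)(K+x) = hKx` and `ρ = (2t/(K+1))(1−x)/K`: `0 < ρ`, `ρ ≤ 2t/((K+1)K)`, `ρ ≤ h/(K+1)`,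
`1/ρ ≤ (K+1)(h + 2·(2t/(K+1)))/(h·(2t/(K+1)))`. [ours] -/
theorem completeGraph_rho_bounds (hK : 1 ≤ K) (ht : 0 < t) {hh x ρ : ℝ} (hhh : 0 < hh) (hx0 : 0 < x) (hx1 : x < 1)
    (hx : 2 * t / ((K : ℝ) + 1) * (1 - x) * (K + x) = hh * K * x) (hρ : ρ = 2 * t / ((K : ℝ) + 1) * (1 - x) / K) :
    ρ * (K + x) = hh * x ∧ 0 < ρ ∧ ρ ≤ 2 * t / ((K : ℝ) + 1) / K ∧ ρ ≤ hh / ((K : ℝ) + 1) ∧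
      1 / ρ ≤ ((K : ℝ) + 1) * (hh + 2 * (2 * t / ((K : ℝ) + 1))) / (hh * (2 * t / ((K : ℝ) + 1))) :=
  starMode_rho_bounds (t := 2 * t / ((K : ℝ) + 1)) hK (by positivity) hhh hx0 hx1 hx hρ

/-- **THE COMPLETE GRAPH IS TWO-SIDED IN THE UNIT `1/ρ ≍ max{K²/t, K/h}`:** the homogeneous weighted scheme on a complete list (every pair listed `c ≥ 1` times, `2m = cK(K+1)`, `K ≥ 1`,
`0 < t < 1`, `w_0 > 0`, `h = (1−t)w_0`, one positive law, exact hot sampler, idle cold kernels) has, with `x ∈ (0,1)` the root of `(2t/(K+1))(1−x)(K+x) = hKx` and `ρ = 2t(1−x)/(K(K+1))`: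
**`((1−ρ)/ρ)·log((1−ν(u))(x+K)/(4√((t+h)/ρ))) ≤ t_mix(1/4) ≤ ⌈(1/ρ)·log(4(x+K)/x)⌉`** for every content `u`. [ours] -/
theorem completeGraph_mixingTime_two_sided (hK : 1 ≤ K) (hm : 1 ≤ m) (he : ∀ r, (e r).1 ≠ (e r).2) {cc : ℕ} (hcc : 1 ≤ cc)
    (hcomplete : ∀ k l : Fin (K + 1), k ≠ l → (univ.filter fun r : Fin m => ((e r).1 = k ∧ (e r).2 = l) ∨ ((e r).2 = k ∧ (e r).1 = l)).card = cc)
    (hmc : (m : ℝ) * 2 = cc * K * ((K : ℝ) + 1)) (hν : ∀ v, 0 < ν v) (hν1 : ∑ v, ν v = 1) (hM0 : ∀ u v, M 0 u v = ν v)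
    (hidle : ∀ i : Fin K, ∀ u v, M i.succ u v = if v = u then 1 else 0) (hw0 : ∀ k, 0 ≤ w k) (hw00 : 0 < w 0) (hw1 : ∑ k, w k = 1) (ht0 : 0 < t) (ht1 : t < 1)
    (hP : ∀ x y, P x y = t * ptGraphSwap (fun _ : Fin (K + 1) => ν) e (fun _ => Equiv.refl S) x y + (1 - t) * prodKernel w M x y)
    {x ρ : ℝ} (hx0 : 0 < x) (hx1 : x < 1) (hx : 2 * t / ((K : ℝ) + 1) * (1 - x) * (K + x) = (1 - t) * w 0 * K * x) (hρ : ρ = 2 * t / ((K : ℝ) + 1) * (1 - x) / K) (u : S) :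
    (1 - ρ) / ρ * Real.log ((1 - ν u) * (x + K) / (4 * Real.sqrt ((t + (1 - t) * w 0) / ρ))) ≤ (mixingTime P (tensorFun (fun _ : Fin (K + 1) => ν)) (1 / 4) : ℝ)
      ∧ mixingTime P (tensorFun (fun _ : Fin (K + 1) => ν)) (1 / 4) ≤ ⌈1 / ρ * Real.log ((x + K) / (x * (1 / 4)))⌉₊ := by
  have hKpos : (0 : ℝ) < K := Nat.cast_pos.mpr (by omega)
  have hhh : 0 < (1 - t) * w 0 := mul_pos (by linarith) hw00
  obtain ⟨hρx, hρ0, hρt, hρh, _⟩ := completeGraph_rho_bounds hK ht0 hhh hx0 hx1 hx hρ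
  have hρ1 : ρ < 1 := by
    have hw01 : w 0 ≤ 1 := by
      calc w 0 ≤ ∑ k, w k := Finset.single_le_sum (fun k _ => hw0 k) (mem_univ 0)
        _ = 1 := hw1
    have : (1 - t) * w 0 / ((K : ℝ) + 1) ≤ (1 - t) * w 0 := div_le_self hhh.le (by linarith)
    nlinarith
  set cv : Fin (K + 1) → ℝ := fun k => if k = 0 then x else 1 with hcv
  have hc0 : cv 0 = x := by simp [hcv]
  have hck : ∀ i : Fin K, cv i.succ = 1 := fun i => by simp [hcv, Fin.succ_ne_zero]
  have hvertex := complete_vertex_equations e hK he hcc hcomplete hmc hc0 hck hρ hx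
  have hcmin : ∀ k, x ≤ cv k := by
    intro k; refine Fin.cases ?_ (fun i => ?_) k
    · rw [hc0]
    · rw [hck]; exact hx1.le
  have hΔ : ∀ r : Fin m, (cv (e r).1 - cv (e r).2) ^ 2 ≤ 1 := by
    intro r
    have h1 : x ≤ cv (e r).1 := hcmin _
    have h2 : x ≤ cv (e r).2 := hcmin _
    have h1' : cv (e r).1 ≤ 1 := by refine Fin.cases ?_ (fun i => ?_) (e r).1 <;> simp [hcv, hx1.le]
    have h2' : cv (e r).2 ≤ 1 := by refine Fin.cases ?_ (fun i => ?_) (e r).2 <;> simp [hcv, hx1.le]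
    nlinarith
  set D : ℝ := Real.sqrt ((t + (1 - t) * w 0) / ρ) with hD
  have hD0 : 0 < D := Real.sqrt_pos.mpr (by positivity)
  have hD2 : (t * 1 + (1 - t) * w 0 * cv 0 ^ 2) / ρ ≤ D ^ 2 := by
    rw [hD, Real.sq_sqrt (by positivity), hc0]
    refine div_le_div_of_nonneg_right ?_ hρ0.le
    have hx2 : x ^ 2 ≤ 1 := by nlinarith
    nlinarith [mul_le_mul_of_nonneg_left hx2 hhh.le]
  have hvertex' : ∀ k : Fin (K + 1), t / m * ∑ r : Fin m, ((if k = (e r).1 then cv (e r).2 - cv (e r).1 else 0) + (if k = (e r).2 then cv (e r).1 - cv (e r).2 else 0))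
      - (if k = 0 then (1 - t) * w 0 * cv 0 else 0) = -ρ * cv k := hvertex
  have htwo := graphScheme_mixingTime_two_sided_mode e hm he hν hν1 hM0 hidle hw0 hw00 hw1 ht0 ht1 hP hρ0 hρ1 hx0 hcmin hvertex' hΔ hD0 hD2 u
  have hsum : ∑ k : Fin (K + 1), cv k = x + K := by
    rw [Fin.sum_univ_succ, hc0]; simp_rw [hck]; simp
  rw [hsum] at htwo
  exact htwo

end Summit.Ventures.LatticeQCDFlow.Scaling

end
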